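import Literature.Algebra.Module.CompositionMultiplicitySemisimple
import Literature.RingTheory.SimpleModule.WedderburnArtinUniquenessSemisimple
import Mathlib.LinearAlgebra.Projection
import Mathlib.LinearAlgebra.Dimension.Constructions
import Mathlib.LinearAlgebra.Dimension.Finite
import Mathlib.LinearAlgebra.FreeModule.Finite.Basic
import Mathlib.RingTheory.SimpleModule.Basic
import HarnessLib

/-!
# Modules over a semisimple algebra are classified by their multiplicities: `M ≅ ⊕ᵢ mᵢSᵢ` with the `mᵢ`
# unique, `⊕ rᵢSᵢ ≅ ⊕ r′ᵢSᵢ ⟺ rᵢ = r′ᵢ`, `M` is faithful iff every `mᵢ > 0`, `dim_k M = Σᵢ mᵢ dim_k Sᵢ`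
# (Milne, *Complex Multiplication*, Ch. I §1 pp. 8–9)

[topic Algebra/Module]

Family `hodge`, lane `lit-hodgefound` (Track 2 foundations library; skeleton seat `lit-hodgefound-skel-3`, generation 61,
row **A3-G146** «the reduced module»), layer `Literature/Algebra/Module`, namespace `Literature.Algebra.Module.JordanHoelder`
(continued).  FILE 1 of the row: the module theory behind Milne's «reduced module» over an ARBITRARY ring `R`, phrased
with p39's composition multiplicities `compMult R M S = [M : S]` (`CompositionMultiplicity{,DirectSum,Semisimple}`:
Jordan–Hölder invariance, additivity, `[⊕ Iᵢ : S] = #{i | Iᵢ ≅ S}`, occurrence ⟺ submodule) and the structure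
idempotents of `RingTheory/SimpleModule/WedderburnArtinUniquenessSemisimple` (a simple module over `R ≅ A₁ × ⋯ × A_r`
lives on exactly one factor), both consumed BY NAME.  THEOREMS ONLY (no definition, no instance, no named fact; net
debt `0`, D-0026).

## The print

J. S. Milne, *Complex Multiplication* (course notes v0.10, 2020) [MilneCM2006], Ch. I §1 «Review of semisimple
algebras and their modules», p. 8 (open text `paper:url-8ccc30e4daab`, p0008 L13–L22), VERBATIM: «We now describe the
modules over a semisimple `k`-algebra `B`. Every such module is semisimple, and hence a direct sum of simple modules.
Thus, it suffices to describe the simple modules. Suppose `B ≈ Mₙ(D)`, and choose an isomorphism; then `Dⁿ` becomes a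
`B`-module under left multiplication; it is simple, and every simple `B`-module is isomorphic to it. Let `B = ∏_{1≤i≤n} Bᵢ`
be the decomposition of `B` into a product of its simple ideals, and let `Sᵢ` be a simple `Bᵢ`-module. When we let `B`
act on `Sᵢ` through the projection `B → Bᵢ`, each `Sᵢ` becomes a simple `B`-module, and every `B`-module is isomorphic to
a direct sum of copies of the `Sᵢ`, `S ≈ ⊕_{i=1}^{n} rᵢSᵢ`; moreover, `⊕ᵢ rᵢSᵢ ≈ ⊕ᵢ r′ᵢSᵢ` if and only if `rᵢ = r′ᵢ` for
all `i`.»; p. 9, proof of Prop. 1.2 (p0009 L31–L36): «let `Sᵢ = Dᵢ^{nᵢ}` be a simple `Bᵢ`-module. Then every `B`-module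
`M` is isomorphic to a sum `⊕ᵢ mᵢSᵢ`, and `M` is faithful if and only if each `mᵢ > 0`. Therefore, if `M` is faithful,
`dim_k M = Σᵢ mᵢnᵢ[Dᵢ:k][kᵢ:k] ≥ Σᵢ nᵢ[Dᵢ:k][kᵢ:k]`.»

Corroborating prints (presearch): T. Y. Lam, *A First Course in Noncommutative Rings* [Lam2001FirstCourse] §3 (3.3)(2),
proof of (3.5) (Jordan–Hölder gives `r = s`, `nᵢ = n′ᵢ`); A. J. Berrick, M. E. Keating [BerrickKeating2000] §4.1.11–4.1.18.

## What is formalised (`R` any ring; `compMult R M S` = `[M : S]` of p39)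

* §1 **«`⊕ rᵢSᵢ ≈ ⊕ r′ᵢSᵢ` if and only if `rᵢ = r′ᵢ`» — SEMISIMPLE MODULES OF FINITE LENGTH ARE DETERMINED UP TO
  ISOMORPHISM BY THEIR COMPOSITION MULTIPLICITIES**: `compMult_eq_add_of_isCompl` (`[M : T] = [S : T] + [C : T]` for
  `M = S ⊕ C`), **`nonempty_linearEquiv_of_forall_compMult_eq`** (universe-heterogeneous: equal multiplicities of all
  simple submodules of `M` and of `N` ⟹ `M ≅ N`; induction on the length, splitting off a common simple summand by
  complements) and the homogeneous iff `nonempty_linearEquiv_iff_forall_compMult_eq`.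
* §2 **«`S ≈ ⊕ᵢ rᵢSᵢ`», THE NORMAL FORM WITH ITS EXPONENTS**: for pairwise non-isomorphic simple `Sᵢ` (`i ∈ ι` finite)
  covering the simple submodules of `M`: `compMult_pi_fin` (`[Πᵢ Sᵢ^{mᵢ} : T] = Σᵢ mᵢ[Sᵢ : T]`),
  `sum_mul_compMult_eq` (`= m_{i₀}` for `T ≅ S_{i₀}`), **`nonempty_linearEquiv_pi_fin_compMult`**
  (`M ≃ₗ[R] Π i, (Fin [M : Sᵢ] → Sᵢ)`), **`eq_compMult_of_linearEquiv_pi_fin`** («the `rᵢ` are uniquely determined»: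
  `M ≅ Πᵢ Sᵢ^{mᵢ}` forces `mᵢ = [M : Sᵢ]`), and over `R ≅ A₁ × ⋯ × A_r` (simple Artinian factors, one simple `Sᵢ` on
  each factor) `nonempty_linearEquiv_pi_fin_compMult_of_ringEquiv` (every `R`-module of finite length).
* §3 **«`M` is faithful if and only if each `mᵢ > 0`»** over a SEMISIMPLE ring: `faithful_iff_forall_compMult_ideal_pos`
  (faithful ⟺ every minimal left ideal occurs in `M`; `1 ∈ Σ` minimal left ideals), `faithful_iff_forall_compMult_pos`
  (for any covering family of simple representatives), `faithful_iff_forall_pos_of_linearEquiv_pi_fin` (read on a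
  normal form `M ≅ Πᵢ Sᵢ^{mᵢ}`).
* §4 **«`dim_k M = Σᵢ mᵢ dim_k Sᵢ`»** over a field `F` (`R` an `F`-algebra, compatible `F`-structures):
  `finrank_eq_sum_mul_finrank_of_linearEquiv_pi_fin`, **`finrank_eq_sum_compMult_mul_finrank`**, and the faithful
  lower bound `sum_finrank_le_finrank_of_faithful` («`≥ Σᵢ nᵢ[Dᵢ:k][kᵢ:k]`» = `Σᵢ dim_k Sᵢ`).

## References

* [MilneCM2006] J. S. Milne, *Complex Multiplication* (2006/2020), Ch. I §1 pp. 8–9 (modules over a semisimple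
  algebra; proof of Prop. 1.2).
* [Lam2001FirstCourse] T. Y. Lam, *A First Course in Noncommutative Rings*, 2nd ed. (2001), §3 (3.3)(2), (3.5).
* [BerrickKeating2000] A. J. Berrick, M. E. Keating, *An Introduction to Rings and Modules* (2000), §4.1.11–4.1.18.
-/

noncomputable section

open Module Submodule

namespace Literature.Algebra.Module

namespace JordanHoelder

open Literature.RingTheory.SimpleModule

universe u v w w'

variable {R : Type u} [Ring R]

/-! ## §1 «`⊕ rᵢSᵢ ≈ ⊕ r′ᵢSᵢ` iff `rᵢ = r′ᵢ`»: semisimple modules are determined by their multiplicities -/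

section Classification

variable {M : Type v} [AddCommGroup M] [Module R M] {N : Type w} [AddCommGroup N] [Module R N]

/-- **Splitting off a summand: `[M : T] = [S : T] + [C : T]` for `M = S ⊕ C`** (internal complement, `M` of finite
length). [cite: MilneCM2006, Ch. I §1 p. 8] [cite: BerrickKeating2000, Thm. 4.1.12 (ii)] -/
theorem compMult_eq_add_of_isCompl {S C : Submodule R M} (h : IsCompl S C) (hM : IsFiniteLength R M)
    (T : Type w') [AddCommGroup T] [Module R T] : compMult R M T = compMult R S T + compMult R C T := by
  rw [← compMult_congr_left T (Submodule.prodEquivOfIsCompl S C h)]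
  exact compMult_prod T (isFiniteLength_submodule S hM) (isFiniteLength_submodule C hM)

/-- The induction behind `nonempty_linearEquiv_of_forall_compMult_eq`, on the length of `M` (both modules vary).
[cite: MilneCM2006, Ch. I §1 p. 8] [cite: Lam2001FirstCourse, §3 proof of (3.5)] -/
private theorem nonempty_linearEquiv_aux (n : ℕ) :
    ∀ (M : Type v) (N : Type w) [AddCommGroup M] [Module R M] [AddCommGroup N] [Module R N]
      [IsSemisimpleModule R M] [IsSemisimpleModule R N],
      IsFiniteLength R M → IsFiniteLength R N → Module.length R M = n →
      (∀ S : Submodule R M, IsSimpleModule R S → compMult R M S = compMult R N S) →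
      (∀ S : Submodule R N, IsSimpleModule R S → compMult R M S = compMult R N S) →
      Nonempty (M ≃ₗ[R] N) := by
  induction n with
  | zero =>
    intro M N _ _ _ _ _ _ hM hN hlen h₁ h₂
    haveI : Subsingleton M := Module.length_eq_zero_iff.mp (by exact_mod_cast hlen)
    -- `N = 0` as well: a simple submodule of `N` would occur in `M = 0`
    haveI : Subsingleton N := by
      by_contra hN'
      haveI : Nontrivial N := not_subsingleton_iff_nontrivial.mp hN'
      obtain ⟨S, hS⟩ := IsSemisimpleModule.exists_simple_submodule R N
      haveI := hS
      have h := h₂ S hS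
      rw [compMult_of_subsingleton (M := M) S] at h
      exact (Nat.pos_iff_ne_zero.mp (compMult_pos_of_injective S hN S.subtype S.injective_subtype)) h.symm
    exact ⟨LinearEquiv.ofSubsingleton M N⟩
  | succ n ih =>
    intro M N _ _ _ _ _ _ hM hN hlen h₁ h₂
    -- `M ≠ 0`: pick a simple submodule `S ≤ M`
    haveI : Nontrivial M := Module.length_pos_iff.mp (by rw [hlen]; exact_mod_cast Nat.succ_pos n)
    obtain ⟨S, hS⟩ := IsSemisimpleModule.exists_simple_submodule R M
    haveI := hS
    -- `S` occurs in `N`: `S ≅ S' ≤ N`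
    have hpos : 0 < compMult R N S := by
      rw [← h₁ S hS]
      exact compMult_pos_of_injective S hM S.subtype S.injective_subtype
    obtain ⟨f, hf⟩ := exists_injective_of_compMult_pos S hpos
    let S' : Submodule R N := LinearMap.range f
    let e₀ : S ≃ₗ[R] S' := LinearEquiv.ofInjective f hf
    haveI : IsSimpleModule R S' := IsSimpleModule.congr e₀.symm
    -- complements `M = S ⊕ C`, `N = S' ⊕ D`
    obtain ⟨C, hC⟩ := exists_isCompl S
    obtain ⟨D, hD⟩ := exists_isCompl S'
    let eM : (S × C) ≃ₗ[R] M := Submodule.prodEquivOfIsCompl S C hC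
    let eN : (S' × D) ≃ₗ[R] N := Submodule.prodEquivOfIsCompl S' D hD
    have hCfl : IsFiniteLength R C := isFiniteLength_submodule C hM
    have hDfl : IsFiniteLength R D := isFiniteLength_submodule D hN
    -- `ℓ(C) = n`
    have hlenC : Module.length R C = n := by
      obtain ⟨m, hm⟩ := ENat.ne_top_iff_exists.mp (Module.length_ne_top_iff.mpr hCfl)
      have key : Module.length R M = 1 + Module.length R C := by
        rw [← eM.length_eq, Module.length_prod, Module.length_eq_one]
      rw [hlen, ← hm] at key
      have hnm : n + 1 = 1 + m := by exact_mod_cast key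
      rw [← hm]
      have : m = n := by omega
      rw [this]
    -- the multiplicities of `C` and `D` agree
    have hsplitM : ∀ (T : Type v) [AddCommGroup T] [Module R T],
        compMult R M T = compMult R S T + compMult R C T := fun T _ _ => compMult_eq_add_of_isCompl hC hM T
    have hsplitM' : ∀ (T : Type w) [AddCommGroup T] [Module R T],
        compMult R M T = compMult R S T + compMult R C T := fun T _ _ => compMult_eq_add_of_isCompl hC hM T
    have hsplitN : ∀ (T : Type v) [AddCommGroup T] [Module R T],
        compMult R N T = compMult R S' T + compMult R D T := fun T _ _ => compMult_eq_add_of_isCompl hD hN T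
    have hsplitN' : ∀ (T : Type w) [AddCommGroup T] [Module R T],
        compMult R N T = compMult R S' T + compMult R D T := fun T _ _ => compMult_eq_add_of_isCompl hD hN T
    have h₁' : ∀ T : Submodule R C, IsSimpleModule R T → compMult R C T = compMult R D T := by
      intro T hT
      haveI := hT
      let X : Submodule R M := T.map C.subtype
      let eTX : T ≃ₗ[R] X := Submodule.equivMapOfInjective C.subtype C.injective_subtype T
      haveI hX : IsSimpleModule R X := IsSimpleModule.congr eTX.symm
      have h := h₁ X hX
      rw [hsplitM X, hsplitN X, compMult_congr_left X e₀] at h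
      have h' : compMult R C X = compMult R D X := Nat.add_left_cancel h
      rwa [← compMult_congr_right (M := C) T eTX, ← compMult_congr_right (M := D) T eTX] at h'
    have h₂' : ∀ T : Submodule R D, IsSimpleModule R T → compMult R C T = compMult R D T := by
      intro T hT
      haveI := hT
      let X : Submodule R N := T.map D.subtype
      let eTX : T ≃ₗ[R] X := Submodule.equivMapOfInjective D.subtype D.injective_subtype T
      haveI hX : IsSimpleModule R X := IsSimpleModule.congr eTX.symm
      have h := h₂ X hX
      rw [hsplitM' X, hsplitN' X, compMult_congr_left X e₀] at h
      have h' : compMult R C X = compMult R D X := Nat.add_left_cancel h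
      rwa [← compMult_congr_right (M := C) T eTX, ← compMult_congr_right (M := D) T eTX] at h'
    obtain ⟨eCD⟩ := ih C D hCfl hDfl hlenC h₁' h₂'
    exact ⟨eM.symm.trans ((e₀.prodCongr eCD).trans eN)⟩

/-- **MILNE CM Ch. I §1 p. 8 «`⊕ᵢ rᵢSᵢ ≈ ⊕ᵢ r′ᵢSᵢ` if and only if `rᵢ = r′ᵢ` for all `i`» — TWO SEMISIMPLE MODULES OF
FINITE LENGTH WITH THE SAME COMPOSITION MULTIPLICITIES ARE ISOMORPHIC** (any ring; the multiplicities are tested on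
the simple submodules of `M` and of `N`, so `M` and `N` may live in different universes).  Proof: induction on `ℓ(M)`; a
simple `S ≤ M` occurs in `N`, `S ≅ S′ ≤ N`; complements `M = S ⊕ C`, `N = S′ ⊕ D` have again equal multiplicities
(`[M : T] = [S : T] + [C : T]`), so `C ≅ D` and `M ≅ S × C ≅ S′ × D ≅ N`.
[cite: MilneCM2006, Ch. I §1 p. 8] [cite: Lam2001FirstCourse, §3 proof of (3.5)] -/
theorem nonempty_linearEquiv_of_forall_compMult_eq [IsSemisimpleModule R M] [IsSemisimpleModule R N]
    (hM : IsFiniteLength R M) (hN : IsFiniteLength R N)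
    (h₁ : ∀ S : Submodule R M, IsSimpleModule R S → compMult R M S = compMult R N S)
    (h₂ : ∀ S : Submodule R N, IsSimpleModule R S → compMult R M S = compMult R N S) :
    Nonempty (M ≃ₗ[R] N) := by
  obtain ⟨n, hn⟩ := ENat.ne_top_iff_exists.mp (Module.length_ne_top_iff.mpr hM)
  exact nonempty_linearEquiv_aux n M N hM hN hn.symm h₁ h₂

/-- **«`⊕ rᵢSᵢ ≈ ⊕ r′ᵢSᵢ` iff `rᵢ = r′ᵢ`» as an iff**: two semisimple `R`-modules of finite length (in one universe) are
isomorphic iff every simple module has the same multiplicity in both. [cite: MilneCM2006, Ch. I §1 p. 8]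
[cite: BerrickKeating2000, §4.1.11, Thm. 4.1.16] -/
theorem nonempty_linearEquiv_iff_forall_compMult_eq {M N : Type v} [AddCommGroup M] [Module R M] [AddCommGroup N]
    [Module R N] [IsSemisimpleModule R M] [IsSemisimpleModule R N] (hM : IsFiniteLength R M)
    (hN : IsFiniteLength R N) :
    Nonempty (M ≃ₗ[R] N) ↔
      ∀ (S : Type v) [AddCommGroup S] [Module R S], IsSimpleModule R S → compMult R M S = compMult R N S :=
  ⟨fun ⟨e⟩ S _ _ _ => compMult_congr_left S e,
    fun h => nonempty_linearEquiv_of_forall_compMult_eq hM hN (fun S hS => h S hS) (fun S hS => h S hS)⟩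

end Classification

/-! ## §2 «`S ≈ ⊕ᵢ rᵢSᵢ`»: the normal form and the uniqueness of its exponents -/

section NormalForm

variable {ι : Type*} [Fintype ι] (S : ι → Type w) [∀ i, AddCommGroup (S i)] [∀ i, Module R (S i)]
  [∀ i, IsSimpleModule R (S i)] {M : Type v} [AddCommGroup M] [Module R M]

/-- **`[Πᵢ Sᵢ^{mᵢ} : T] = Σᵢ mᵢ [Sᵢ : T]`** (additivity of the multiplicity type on finite products).
[cite: MilneCM2006, Ch. I §1 p. 8] [cite: BerrickKeating2000, Thm. 4.1.12 (ii)] -/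
theorem compMult_pi_fin (m : ι → ℕ) (T : Type w') [AddCommGroup T] [Module R T] :
    compMult R (Π i, (Fin (m i) → S i)) T = ∑ i, m i * compMult R (S i) T := by
  rw [compMult_pi_of_fintype T (fun i => Fin (m i) → S i)
    (fun i => (isFiniteLength_pi_iff _).mpr fun _ => isFiniteLength_of_isSimpleModule (S i))]
  refine Finset.sum_congr rfl fun i _ => ?_
  rw [compMult_pi_of_fintype T (fun _ : Fin (m i) => S i) (fun _ => isFiniteLength_of_isSimpleModule (S i)),
    Finset.sum_const, Finset.card_univ, Fintype.card_fin, smul_eq_mul]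

/-- For pairwise non-isomorphic simple `Sᵢ` and a simple `T ≅ S_{i₀}`: **`Σᵢ mᵢ[Sᵢ : T] = m_{i₀}`** («clearly
`Vᵢ ≇ Vⱼ` if `i ≠ j`»). [cite: MilneCM2006, Ch. I §1 p. 8] [cite: Lam2001FirstCourse, §3 proof of (3.5)] -/
theorem sum_mul_compMult_eq (hS : ∀ i j, Nonempty (S i ≃ₗ[R] S j) → i = j) (m : ι → ℕ)
    {T : Type w'} [AddCommGroup T] [Module R T] {i₀ : ι} (e : S i₀ ≃ₗ[R] T) :
    ∑ i, m i * compMult R (S i) T = m i₀ := by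
  rw [Finset.sum_eq_single i₀]
  · rw [← compMult_congr_right (M := S i₀) (S i₀) e, compMult_self (S i₀), mul_one]
  · intro i _ hi
    rw [compMult_of_isSimpleModule_of_isEmpty T ⟨fun f => hi (hS i i₀ ⟨f.trans e.symm⟩)⟩, mul_zero]
  · intro h
    exact absurd (Finset.mem_univ i₀) h

/-- `[M : T] = [Πᵢ Sᵢ^{[M:Sᵢ]} : T]` for every `T` isomorphic to one of the `Sᵢ`. [cite: MilneCM2006, Ch. I §1 p. 8] -/
private theorem compMult_eq_compMult_pi_fin (hS : ∀ i j, Nonempty (S i ≃ₗ[R] S j) → i = j) (M : Type v)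
    [AddCommGroup M] [Module R M] {T : Type w'} [AddCommGroup T] [Module R T] {i₀ : ι} (e : S i₀ ≃ₗ[R] T) :
    compMult R M T = compMult R (Π i, (Fin (compMult R M (S i)) → S i)) T := by
  rw [compMult_pi_fin S _ T, sum_mul_compMult_eq S hS _ e, ← compMult_congr_right (M := M) (S i₀) e]

/-- **MILNE CM Ch. I §1 p. 8 «every `B`-module is isomorphic to a direct sum of copies of the `Sᵢ`, `S ≈ ⊕ᵢ rᵢSᵢ`» — THE
NORMAL FORM `M ≃ₗ[R] Πᵢ Sᵢ^{[M : Sᵢ]}`**: for a finite family of pairwise non-isomorphic simple modules `Sᵢ` such that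
every simple submodule of the semisimple module `M` of finite length is isomorphic to some `Sᵢ`, `M` is isomorphic to
the product of `[M : Sᵢ]` copies of each `Sᵢ` (both sides have the same multiplicities; §1).
[cite: MilneCM2006, Ch. I §1 p. 8] [cite: BerrickKeating2000, Thm. 4.1.16] -/
theorem nonempty_linearEquiv_pi_fin_compMult (hS : ∀ i j, Nonempty (S i ≃ₗ[R] S j) → i = j)
    [IsSemisimpleModule R M] (hM : IsFiniteLength R M)
    (hcov : ∀ T : Submodule R M, IsSimpleModule R T → ∃ i, Nonempty (S i ≃ₗ[R] T)) :
    Nonempty (M ≃ₗ[R] Π i, (Fin (compMult R M (S i)) → S i)) := by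
  have hNfl : IsFiniteLength R (Π i, (Fin (compMult R M (S i)) → S i)) :=
    (isFiniteLength_pi_iff _).mpr fun i =>
      (isFiniteLength_pi_iff _).mpr fun _ => isFiniteLength_of_isSimpleModule (S i)
  refine nonempty_linearEquiv_of_forall_compMult_eq hM hNfl (fun T hT => ?_) (fun T hT => ?_)
  · obtain ⟨i₀, ⟨e⟩⟩ := hcov T hT
    exact compMult_eq_compMult_pi_fin S hS M e
  · -- a simple `T ≤ Πᵢ Sᵢ^{mᵢ}` occurs there, hence is isomorphic to some `S_{i₀}`
    haveI := hT
    have hpos : 0 < compMult R (Π i, (Fin (compMult R M (S i)) → S i)) T :=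
      compMult_pos_of_injective T hNfl T.subtype T.injective_subtype
    rw [compMult_pi_fin S _ T] at hpos
    obtain ⟨i₀, -, hi₀⟩ := Finset.exists_ne_zero_of_sum_ne_zero (Nat.pos_iff_ne_zero.mp hpos)
    have hne : compMult R (S i₀) T ≠ 0 := fun h => hi₀ (by rw [h, mul_zero])
    have hiso : Nonempty (S i₀ ≃ₗ[R] T) := by
      by_contra hn
      exact hne (compMult_of_isSimpleModule_of_isEmpty T (not_nonempty_iff.mp hn))
    obtain ⟨e⟩ := hiso
    exact compMult_eq_compMult_pi_fin S hS M e

/-- **«the `rᵢ` are uniquely determined» (`⊕ rᵢSᵢ ≈ ⊕ r′ᵢSᵢ ⟹ rᵢ = r′ᵢ`): an isomorphism `M ≅ Πᵢ Sᵢ^{mᵢ}` with pairwise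
non-isomorphic simple `Sᵢ` forces `mᵢ = [M : Sᵢ]`.** [cite: MilneCM2006, Ch. I §1 p. 8] [cite: Lam2001FirstCourse, §3 (3.5)] -/
theorem eq_compMult_of_linearEquiv_pi_fin (hS : ∀ i j, Nonempty (S i ≃ₗ[R] S j) → i = j) {m : ι → ℕ}
    (e : M ≃ₗ[R] Π i, (Fin (m i) → S i)) (j : ι) : m j = compMult R M (S j) := by
  rw [compMult_congr_left (S j) e, compMult_pi_fin S m (S j), sum_mul_compMult_eq S hS m (LinearEquiv.refl R (S j))]

/-- Two normal forms on the same representatives are isomorphic iff the exponents agree.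
[cite: MilneCM2006, Ch. I §1 p. 8] -/
theorem nonempty_linearEquiv_pi_fin_iff (hS : ∀ i j, Nonempty (S i ≃ₗ[R] S j) → i = j) (m m' : ι → ℕ) :
    Nonempty ((Π i, (Fin (m i) → S i)) ≃ₗ[R] Π i, (Fin (m' i) → S i)) ↔ m = m' := by
  refine ⟨fun ⟨e⟩ => funext fun j => ?_, ?_⟩
  · rw [eq_compMult_of_linearEquiv_pi_fin S hS e j, ← compMult_congr_left (S j) (LinearEquiv.refl R _),
      ← eq_compMult_of_linearEquiv_pi_fin S hS (LinearEquiv.refl R (Π i, (Fin (m i) → S i))) j]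
  · rintro rfl
    exact ⟨LinearEquiv.refl R _⟩

end NormalForm

/-! ### Over `R ≅ A₁ × ⋯ × A_r` with simple Artinian factors: one simple module on each factor covers everything -/

section Factors

variable {ι : Type*} [Fintype ι] [DecidableEq ι] {A : ι → Type*} [∀ i, Ring (A i)] [∀ i, IsSimpleRing (A i)]
  [∀ i, IsArtinianRing (A i)] (e : R ≃+* (Π i, A i))
  (S : ι → Type w) [∀ i, AddCommGroup (S i)] [∀ i, Module R (S i)] [∀ i, IsSimpleModule R (S i)]
  (hS : ∀ i (x : S i), e.symm (Pi.single i 1) • x = x)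
  {M : Type v} [AddCommGroup M] [Module R M]

include hS

omit [Fintype ι] [∀ i, IsSimpleRing (A i)] [∀ i, IsArtinianRing (A i)] in
/-- Simple modules `Sᵢ` living on the factors `i` of `R ≅ A₁ × ⋯ × A_r` are pairwise non-isomorphic («clearly `Vᵢ ≇ Vⱼ`
if `i ≠ j`»). [cite: Lam2001FirstCourse, §3 proof of (3.5)] [cite: MilneCM2006, Ch. I §1 p. 8] -/
theorem eq_of_nonempty_linearEquiv_factors (i j : ι) (h : Nonempty (S i ≃ₗ[R] S j)) : i = j := by
  haveI := IsSimpleModule.nontrivial R (S i)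
  exact eq_of_nonempty_linearEquiv e (S i) (S j) (hS i) (hS j) h

/-- … and every simple `R`-module is isomorphic to one of them («every simple `B`-module is isomorphic to it»).
[cite: MilneCM2006, Ch. I §1 p. 8] [cite: Lam2001FirstCourse, §3 (3.3)(2) and proof of (3.5)] -/
theorem exists_nonempty_linearEquiv_factors (T : Type w') [AddCommGroup T] [Module R T] [IsSimpleModule R T] :
    ∃ i, Nonempty (S i ≃ₗ[R] T) := by
  obtain ⟨i, hi⟩ := exists_symm_single_one_smul_eq e T
  exact ⟨i, nonempty_linearEquiv_of_symm_single_one_smul_eq e (S i) T (hS i) hi⟩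

/-- **«every `B`-module is isomorphic to a direct sum of copies of the `Sᵢ`» over `R ≅ A₁ × ⋯ × A_r`** (simple Artinian
factors `Aᵢ`, `Sᵢ` a simple module on the `i`-th factor): every semisimple `R`-module of finite length is
`≅ Πᵢ Sᵢ^{[M : Sᵢ]}`. [cite: MilneCM2006, Ch. I §1 p. 8] [cite: Lam2001FirstCourse, §3 (3.3)(2), (3.5)] -/
theorem nonempty_linearEquiv_pi_fin_compMult_of_ringEquiv [IsSemisimpleModule R M] (hM : IsFiniteLength R M) :
    Nonempty (M ≃ₗ[R] Π i, (Fin (compMult R M (S i)) → S i)) :=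
  nonempty_linearEquiv_pi_fin_compMult S (fun i j h => eq_of_nonempty_linearEquiv_factors e S hS i j h) hM
    fun T hT => by
      haveI := hT
      exact exists_nonempty_linearEquiv_factors e S hS T

end Factors

/-! ## §3 «`M` is faithful if and only if each `mᵢ > 0`» (over a semisimple ring) -/

section Faithful

variable {M : Type v} [AddCommGroup M] [Module R M]

/-- **MILNE CM Ch. I §1 p. 9 «`M` is faithful if and only if each `mᵢ > 0`» — over a SEMISIMPLE ring `R`, a module of
finite length is faithful iff every minimal left ideal of `R` (= every simple `R`-module up to isomorphism) OCCURS in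
it.**  (⟹) a non-zero `x` of a minimal left ideal `I` moves some `m ∈ M`, and `y ↦ y·m` is a non-zero `R`-linear map
`I → M`; (⟸) if `r` kills `M` it kills every minimal left ideal (each embeds in `M`), and `1` is a sum of elements of
minimal left ideals, so `r = r·1 = 0`. [cite: MilneCM2006, Ch. I §1 proof of Prop. 1.2 (p. 9)] -/
theorem faithful_iff_forall_compMult_ideal_pos [IsSemisimpleRing R] (hM : IsFiniteLength R M) :
    (∀ r : R, (∀ m : M, r • m = 0) → r = 0) ↔ ∀ I : Ideal R, IsSimpleModule R I → 0 < compMult R M I := by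
  constructor
  · intro hfaith I hI
    haveI := hI
    haveI := IsSimpleModule.nontrivial R I
    obtain ⟨⟨x, hxI⟩, hx⟩ := exists_ne (0 : I)
    have hx' : x ≠ 0 := fun h => hx (Subtype.ext h)
    obtain ⟨m, hm⟩ : ∃ m : M, x • m ≠ 0 := by
      by_contra h
      push Not at h
      exact hx' (hfaith x h)
    let f : I →ₗ[R] M := (LinearMap.toSpanSingleton R M m).comp (Submodule.subtype I)
    have hf : f ≠ 0 := by
      intro h0
      apply hm
      have := LinearMap.congr_fun h0 ⟨x, hxI⟩
      simpa [f] using this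
    exact compMult_pos_of_linearMap_ne_zero I hM f hf
  · intro h r hr
    -- `r` kills every minimal left ideal
    have hkill : ∀ I : Ideal R, IsSimpleModule R I → ∀ y ∈ I, r * y = 0 := by
      intro I hI y hy
      haveI := hI
      obtain ⟨g, hg⟩ := exists_injective_of_compMult_pos I (h I hI)
      have h1 : g (r • ⟨y, hy⟩) = 0 := by rw [map_smul, hr]
      have h2 : (r • ⟨y, hy⟩ : I) = 0 := hg (by rw [h1, map_zero])
      have h3 := congrArg Subtype.val h2
      simpa using h3
    -- `1` is a sum of elements of minimal left ideals
    have h1 : (1 : R) ∈ sSup {I : Submodule R R | IsSimpleModule R I} := by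
      rw [IsSemisimpleModule.sSup_simples_eq_top]
      exact Submodule.mem_top
    rw [sSup_eq_iSup'] at h1
    have key : r * 1 = 0 := by
      refine Submodule.iSup_induction (motive := fun y => r * y = 0) _ h1 ?_ (mul_zero r) ?_
      · rintro ⟨I, hI⟩ y hy
        exact hkill I hI y hy
      · intro x y hx hy
        rw [mul_add, hx, hy, add_zero]
    rwa [mul_one] at key

/-- **«`M` is faithful iff each `mᵢ > 0`» for a covering family of simple representatives**: over a semisimple ring,
if every minimal left ideal is isomorphic to some `Sᵢ`, then `M` (of finite length) is faithful iff `[M : Sᵢ] > 0`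
for every `i`. [cite: MilneCM2006, Ch. I §1 proof of Prop. 1.2 (p. 9)] -/
theorem faithful_iff_forall_compMult_pos [IsSemisimpleRing R] (hM : IsFiniteLength R M) {ι : Type*}
    (S : ι → Type w) [∀ i, AddCommGroup (S i)] [∀ i, Module R (S i)] [∀ i, IsSimpleModule R (S i)]
    (hcov : ∀ I : Ideal R, IsSimpleModule R I → ∃ i, Nonempty (S i ≃ₗ[R] I)) :
    (∀ r : R, (∀ m : M, r • m = 0) → r = 0) ↔ ∀ i, 0 < compMult R M (S i) := by
  rw [faithful_iff_forall_compMult_ideal_pos hM]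
  constructor
  · intro h i
    obtain ⟨I, ⟨e⟩⟩ := IsSemisimpleRing.exists_linearEquiv_ideal_of_isSimpleModule (R := R) (M := S i)
    haveI : IsSimpleModule R I := IsSimpleModule.congr e.symm
    rw [compMult_congr_right (M := M) (S i) e]
    exact h I ‹_›
  · intro h I hI
    obtain ⟨i, ⟨e⟩⟩ := hcov I hI
    rw [← compMult_congr_right (M := M) (S i) e]
    exact h i

/-- **«every `B`-module `M` is isomorphic to a sum `⊕ mᵢSᵢ`, and `M` is faithful if and only if each `mᵢ > 0`»** read on a
normal form: over a semisimple ring, for pairwise non-isomorphic simple `Sᵢ` covering the minimal left ideals and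
`M ≅ Πᵢ Sᵢ^{mᵢ}`, `M` is faithful iff every `mᵢ > 0`. [cite: MilneCM2006, Ch. I §1 proof of Prop. 1.2 (p. 9)] -/
theorem faithful_iff_forall_pos_of_linearEquiv_pi_fin [IsSemisimpleRing R] {ι : Type*} [Fintype ι]
    (S : ι → Type w) [∀ i, AddCommGroup (S i)] [∀ i, Module R (S i)] [∀ i, IsSimpleModule R (S i)]
    (hS : ∀ i j, Nonempty (S i ≃ₗ[R] S j) → i = j)
    (hcov : ∀ I : Ideal R, IsSimpleModule R I → ∃ i, Nonempty (S i ≃ₗ[R] I)) {m : ι → ℕ}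
    (e : M ≃ₗ[R] Π i, (Fin (m i) → S i)) :
    (∀ r : R, (∀ x : M, r • x = 0) → r = 0) ↔ ∀ i, 0 < m i := by
  have hNfl : IsFiniteLength R (Π i, (Fin (m i) → S i)) :=
    (isFiniteLength_pi_iff _).mpr fun i => (isFiniteLength_pi_iff _).mpr fun _ => isFiniteLength_of_isSimpleModule (S i)
  have hM : IsFiniteLength R M := isFiniteLength_of_linearEquiv e.symm hNfl
  rw [faithful_iff_forall_compMult_pos hM S hcov]
  exact forall_congr' fun i => by rw [← eq_compMult_of_linearEquiv_pi_fin S hS e i]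

end Faithful

/-! ## §4 «`dim_k M = Σᵢ mᵢ dim_k Sᵢ`» (over a field) -/

section Dimension

variable {F : Type*} [Field F] [Algebra F R] {ι : Type*} [Fintype ι] (S : ι → Type w) [∀ i, AddCommGroup (S i)]
  [∀ i, Module R (S i)] [∀ i, Module F (S i)] [∀ i, IsScalarTower F R (S i)] [∀ i, Module.Finite F (S i)]
  {M : Type v} [AddCommGroup M] [Module R M] [Module F M] [IsScalarTower F R M]

/-- **`dim_F M = Σᵢ mᵢ dim_F Sᵢ` for `M ≅ Πᵢ Sᵢ^{mᵢ}`** (an `R`-isomorphism is `F`-linear for compatible `F`-structures).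
[cite: MilneCM2006, Ch. I §1 proof of Prop. 1.2 «`dim_k M = Σᵢ mᵢnᵢ[Dᵢ:k][kᵢ:k]`» (p. 9)] -/
theorem finrank_eq_sum_mul_finrank_of_linearEquiv_pi_fin {m : ι → ℕ} (e : M ≃ₗ[R] Π i, (Fin (m i) → S i)) :
    finrank F M = ∑ i, m i * finrank F (S i) := by
  rw [(e.restrictScalars F).finrank_eq, Module.finrank_pi_fintype F]
  exact Finset.sum_congr rfl fun i _ => by
    rw [Module.finrank_pi_fintype F, Finset.sum_const, Finset.card_univ, Fintype.card_fin, smul_eq_mul]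

/-- **MILNE CM Ch. I §1 p. 9 «Therefore `dim_k M = Σᵢ mᵢnᵢ[Dᵢ:k][kᵢ:k]`», i.e. `dim_F M = Σᵢ [M : Sᵢ]·dim_F Sᵢ`** for a
semisimple `M` of finite length and pairwise non-isomorphic simple `Sᵢ` covering its simple submodules (in Milne's
setting `dim_k Sᵢ = nᵢ[Dᵢ:k]` — the tree's `NoetherDeuring.finrank_eq_of_symm_single_one_smul_eq`).
[cite: MilneCM2006, Ch. I §1 proof of Prop. 1.2 (p. 9)] -/
theorem finrank_eq_sum_compMult_mul_finrank [∀ i, IsSimpleModule R (S i)]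
    (hS : ∀ i j, Nonempty (S i ≃ₗ[R] S j) → i = j) [IsSemisimpleModule R M] (hM : IsFiniteLength R M)
    (hcov : ∀ T : Submodule R M, IsSimpleModule R T → ∃ i, Nonempty (S i ≃ₗ[R] T)) :
    finrank F M = ∑ i, compMult R M (S i) * finrank F (S i) := by
  obtain ⟨e⟩ := nonempty_linearEquiv_pi_fin_compMult S hS hM hcov
  exact finrank_eq_sum_mul_finrank_of_linearEquiv_pi_fin S e

/-- **«if `M` is faithful, `dim_k M = Σᵢ mᵢ dim_k Sᵢ ≥ Σᵢ dim_k Sᵢ`»**: over a semisimple ring with pairwise non-isomorphic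
simple `Sᵢ` covering the minimal left ideals, a FAITHFUL `M ≅ Πᵢ Sᵢ^{mᵢ}` has `Σᵢ dim_F Sᵢ ≤ dim_F M`, with equality
iff every `mᵢ = 1`. [cite: MilneCM2006, Ch. I §1 proof of Prop. 1.2 (p. 9)] -/
theorem sum_finrank_le_finrank_of_faithful [IsSemisimpleRing R] [∀ i, IsSimpleModule R (S i)]
    (hS : ∀ i j, Nonempty (S i ≃ₗ[R] S j) → i = j)
    (hcov : ∀ I : Ideal R, IsSimpleModule R I → ∃ i, Nonempty (S i ≃ₗ[R] I)) {m : ι → ℕ}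
    (e : M ≃ₗ[R] Π i, (Fin (m i) → S i)) (hfaith : ∀ r : R, (∀ x : M, r • x = 0) → r = 0) :
    ∑ i, finrank F (S i) ≤ finrank F M ∧ (∑ i, finrank F (S i) = finrank F M ↔ ∀ i, m i = 1) := by
  have hpos : ∀ i, 0 < m i := (faithful_iff_forall_pos_of_linearEquiv_pi_fin S hS hcov e).mp hfaith
  have hdim := finrank_eq_sum_mul_finrank_of_linearEquiv_pi_fin (F := F) S e
  have hSpos : ∀ i, 0 < finrank F (S i) := fun i => by
    haveI := IsSimpleModule.nontrivial R (S i)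
    exact Module.finrank_pos
  rw [hdim]
  refine ⟨Finset.sum_le_sum fun i _ => Nat.le_mul_of_pos_left _ (hpos i), ⟨fun h i => ?_, fun h => ?_⟩⟩
  · -- termwise `dim Sᵢ ≤ mᵢ dim Sᵢ` with equal sums forces equality termwise
    have hle : ∀ j ∈ Finset.univ, finrank F (S j) ≤ m j * finrank F (S j) :=
      fun j _ => Nat.le_mul_of_pos_left _ (hpos j)
    have heq := (Finset.sum_eq_sum_iff_of_le hle).mp h i (Finset.mem_univ i)
    have : m i * finrank F (S i) = 1 * finrank F (S i) := by rw [one_mul]; exact heq.symm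
    exact Nat.eq_of_mul_eq_mul_right (hSpos i) this
  · exact Finset.sum_congr rfl fun i _ => by rw [h i, one_mul]

end Dimension

end JordanHoelder

end Literature.Algebra.Module
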